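import Literature.Analysis.Calculus.SmoothCutoff
import Mathlib.Analysis.Calculus.Deriv.MeanValue
import HarnessLib

/-!
# `ParametricKerrBurial`, line `null-shell-shadow-collar` — stub `stub_capping`, I: smooth corners for the profile of the cap

Support file (everything proved; no definitions, no named facts) for stub `stub_capping` of crux
`stmt-FinalStateConjecture-10052` (`Summit.FinalStateConjecture.FinalStateConjecture.Theses.SwallowTheDatum.ParametricKerrBurial`).
The cap continues an exact Schwarzschild CYLINDER `{r = r₀}`, `0 < r₀ < 2m`, of the ingoing Kerr–Schild chart by ONE
spherically symmetric hypersurface `y ↦ (t* = τ(s), x = (ϱ(s)/s) y)`, `s = ‖y‖`; its profile (`…CappingProfile`) is built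
from `Real.smoothTransition =: S` and the elementary pieces proved here:

* the STOP corner `H(x) = x (1 − S(x + 1))`: `H = id` on `(−∞, −1]`, `H = 0` on `[0, ∞)`, `H′ ≥ 0`;
* the START corner `K(x) = x (1 − S x)`: `K = id` on `(−∞, 0]`, `K = 0` on `[1, ∞)`, `K′ ≤ 1`;
* the HEIGHT `τ(s) = ε H((s − s₁)/ε)`: `= s − s₁` (unit `t*`-speed up the cylinder) for `s ≤ s₁ − ε`, `= 0` from `s₁`
  on, `τ′ ≥ 0`;
* the OUTER RADIAL CHART `ϱ₃(s) = s + d − d S(s − s₁ − 1)` (`d ≤ 0`): `= s + d` below `s₁ + 1`, `= s` beyond `s₁ + 2`,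
  slope `≥ 1`, a smooth strictly increasing bijection of `ℝ` with smooth inverse (`exists_outer_inverse`, by
  `Homeomorph.contDiff_symm_deriv` as in `…KerrShieldedDataExistAssemblyProfile`).

References: Li–Mei arXiv:2005.01249 §4 (the spacelike cylinder `{r = r₀ < 2m}`); O'Neill 1983, Ch. 13
(Schwarzschild in ingoing coordinates); the line card `Cruxes/ParametricKerrBurial/Lines/null-shell-shadow-collar.md`.
-/

-- the doubled `FinalStateConjecture` path component is the summit/problem naming scheme, not a mistake
set_option linter.dupNamespace false

noncomputable section

open Real Set Filter Topology
open scoped ContDiff Topology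
open Literature.Analysis.Calculus (differentiable_smoothTransition deriv_smoothTransition_of_nonpos
  deriv_smoothTransition_of_one_le)

namespace Summit.FinalStateConjecture.FinalStateConjecture.Theorems.SwallowTheDatum.ParametricKerrBurial

namespace Capping

/-! ### The smooth step and the two corners -/

section Corners

/-- Chain rule for `x ↦ S(a x + b)`. [folklore] -/
theorem hasDerivAt_smoothTransition_affine (a b x : ℝ) :
    HasDerivAt (fun x : ℝ ↦ smoothTransition (a * x + b)) (deriv smoothTransition (a * x + b) * a) x := by
  have hin : HasDerivAt (fun x : ℝ ↦ a * x + b) a x := by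
    simpa using ((hasDerivAt_id' x).const_mul a).add_const b
  exact (differentiable_smoothTransition _).hasDerivAt.comp x hin

/-- `x ↦ S(a x + b)` is `C^∞`. [folklore] -/
theorem contDiff_smoothTransition_affine (a b : ℝ) : ContDiff ℝ ∞ (fun x : ℝ ↦ smoothTransition (a * x + b)) :=
  smoothTransition.contDiff.comp ((contDiff_const.mul contDiff_id).add contDiff_const)

/-- **The stop corner** `H(x) = x (1 − S(x+1))` has derivative `(1 − S(x+1)) − x S′(x+1)`. [folklore] -/
theorem hasDerivAt_stopCorner (x : ℝ) :
    HasDerivAt (fun x : ℝ ↦ x * (1 - smoothTransition (x + 1)))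
      ((1 - smoothTransition (x + 1)) - x * deriv smoothTransition (x + 1)) x := by
  have hS : HasDerivAt (fun x : ℝ ↦ smoothTransition (x + 1)) (deriv smoothTransition (x + 1)) x := by
    simpa using hasDerivAt_smoothTransition_affine 1 1 x
  have h := (hasDerivAt_id' x).fun_mul (hS.const_sub 1)
  refine h.congr_deriv ?_
  ring

/-- The stop corner is `C^∞`. [folklore] -/
theorem contDiff_stopCorner : ContDiff ℝ ∞ (fun x : ℝ ↦ x * (1 - smoothTransition (x + 1))) := by
  have hS : ContDiff ℝ ∞ (fun x : ℝ ↦ smoothTransition (x + 1)) := by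
    simpa using contDiff_smoothTransition_affine 1 1
  exact contDiff_id.mul (contDiff_const.sub hS)

/-- The stop corner is the identity on `(−∞, −1]`. [folklore] -/
theorem stopCorner_of_le {x : ℝ} (hx : x ≤ -1) : x * (1 - smoothTransition (x + 1)) = x := by
  rw [smoothTransition.zero_of_nonpos (by linarith), sub_zero, mul_one]

/-- The stop corner vanishes on `[0, ∞)`. [folklore] -/
theorem stopCorner_of_nonneg {x : ℝ} (hx : 0 ≤ x) : x * (1 - smoothTransition (x + 1)) = 0 := by
  rw [smoothTransition.one_of_one_le (by linarith), sub_self, mul_zero]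

/-- The derivative of the stop corner is `1` on `(−∞, −1]`. [folklore] -/
theorem deriv_stopCorner_of_le {x : ℝ} (hx : x ≤ -1) :
    deriv (fun x : ℝ ↦ x * (1 - smoothTransition (x + 1))) x = 1 := by
  rw [(hasDerivAt_stopCorner x).deriv, smoothTransition.zero_of_nonpos (by linarith),
    deriv_smoothTransition_of_nonpos (by linarith)]
  ring

/-- The derivative of the stop corner is `0` on `[0, ∞)`. [folklore] -/
theorem deriv_stopCorner_of_nonneg {x : ℝ} (hx : 0 ≤ x) :
    deriv (fun x : ℝ ↦ x * (1 - smoothTransition (x + 1))) x = 0 := by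
  rw [(hasDerivAt_stopCorner x).deriv, smoothTransition.one_of_one_le (by linarith),
    deriv_smoothTransition_of_one_le (by linarith)]
  ring

/-- **The stop corner is monotone**: its derivative is nonnegative (`1 − S ≥ 0`; `−x S′(x+1) ≥ 0` for `x ≤ 0`,
and both terms vanish for `x ≥ 0`). [folklore] -/
theorem deriv_stopCorner_nonneg (x : ℝ) : 0 ≤ deriv (fun x : ℝ ↦ x * (1 - smoothTransition (x + 1))) x := by
  rcases le_or_gt x 0 with hx | hx
  · rw [(hasDerivAt_stopCorner x).deriv]
    have h1 : 0 ≤ 1 - smoothTransition (x + 1) := sub_nonneg.2 (smoothTransition.le_one _)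
    have h2 : 0 ≤ -x * deriv smoothTransition (x + 1) := mul_nonneg (by linarith) smoothTransition.monotone.deriv_nonneg
    linarith
  · rw [deriv_stopCorner_of_nonneg hx.le]

/-- **The start corner** `K(x) = x (1 − S x)` has derivative `(1 − S x) − x S′(x)`. [folklore] -/
theorem hasDerivAt_startCorner (x : ℝ) :
    HasDerivAt (fun x : ℝ ↦ x * (1 - smoothTransition x))
      ((1 - smoothTransition x) - x * deriv smoothTransition x) x := by
  have h := (hasDerivAt_id' x).fun_mul ((differentiable_smoothTransition x).hasDerivAt.const_sub 1)
  refine h.congr_deriv ?_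
  ring

/-- The start corner is `C^∞`. [folklore] -/
theorem contDiff_startCorner : ContDiff ℝ ∞ (fun x : ℝ ↦ x * (1 - smoothTransition x)) :=
  contDiff_id.mul (contDiff_const.sub smoothTransition.contDiff)

/-- The start corner is the identity on `(−∞, 0]`. [folklore] -/
theorem startCorner_of_nonpos {x : ℝ} (hx : x ≤ 0) : x * (1 - smoothTransition x) = x := by
  rw [smoothTransition.zero_of_nonpos hx, sub_zero, mul_one]

/-- The start corner vanishes on `[1, ∞)`. [folklore] -/
theorem startCorner_of_one_le {x : ℝ} (hx : 1 ≤ x) : x * (1 - smoothTransition x) = 0 := by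
  rw [smoothTransition.one_of_one_le hx, sub_self, mul_zero]

/-- The derivative of the start corner is `1` on `(−∞, 0]`. [folklore] -/
theorem deriv_startCorner_of_nonpos {x : ℝ} (hx : x ≤ 0) :
    deriv (fun x : ℝ ↦ x * (1 - smoothTransition x)) x = 1 := by
  rw [(hasDerivAt_startCorner x).deriv, smoothTransition.zero_of_nonpos hx, deriv_smoothTransition_of_nonpos hx]
  ring

/-- The derivative of the start corner is `0` on `[1, ∞)`. [folklore] -/
theorem deriv_startCorner_of_one_le {x : ℝ} (hx : 1 ≤ x) :
    deriv (fun x : ℝ ↦ x * (1 - smoothTransition x)) x = 0 := by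
  rw [(hasDerivAt_startCorner x).deriv, smoothTransition.one_of_one_le hx, deriv_smoothTransition_of_one_le hx]
  ring

/-- **The start corner has slope at most one**: `1 − K′(x) = S x + x S′(x) ≥ 0` (for `x ≥ 0` both terms are
nonnegative, for `x ≤ 0` both vanish). [folklore] -/
theorem deriv_startCorner_le_one (x : ℝ) : deriv (fun x : ℝ ↦ x * (1 - smoothTransition x)) x ≤ 1 := by
  rcases le_or_gt x 0 with hx | hx
  · rw [deriv_startCorner_of_nonpos hx]
  · rw [(hasDerivAt_startCorner x).deriv]
    have h1 : 0 ≤ smoothTransition x := smoothTransition.nonneg _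
    have h2 : 0 ≤ x * deriv smoothTransition x := mul_nonneg hx.le smoothTransition.monotone.deriv_nonneg
    linarith

end Corners

/-! ### The height profile `τ(s) = ε H((s − s₁)/ε)` -/

section Height

variable {ε s₁ : ℝ}

/-- The height profile is `C^∞`. [folklore] -/
theorem contDiff_height :
    ContDiff ℝ ∞ (fun s : ℝ ↦ ε * ((s - s₁) / ε * (1 - smoothTransition ((s - s₁) / ε + 1)))) := by
  have hin : ContDiff ℝ ∞ (fun s : ℝ ↦ (s - s₁) / ε) := (contDiff_id.sub contDiff_const).div_const ε
  exact contDiff_const.mul (contDiff_stopCorner.comp hin)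

/-- The derivative of the height profile is `H′((s − s₁)/ε)`. [folklore] -/
theorem hasDerivAt_height (hε : 0 < ε) (s : ℝ) :
    HasDerivAt (fun s : ℝ ↦ ε * ((s - s₁) / ε * (1 - smoothTransition ((s - s₁) / ε + 1))))
      (deriv (fun x : ℝ ↦ x * (1 - smoothTransition (x + 1))) ((s - s₁) / ε)) s := by
  have hin : HasDerivAt (fun s : ℝ ↦ (s - s₁) / ε) ε⁻¹ s := by
    simpa [div_eq_mul_inv] using ((hasDerivAt_id' s).sub_const s₁).mul_const ε⁻¹
  have hH := (hasDerivAt_stopCorner ((s - s₁) / ε)).comp s hin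
  have h := hH.const_mul ε
  rw [(hasDerivAt_stopCorner ((s - s₁) / ε)).deriv]
  refine h.congr_deriv ?_
  field_simp

/-- The derivative of the height profile, as a `deriv`. [folklore] -/
theorem deriv_height (hε : 0 < ε) (s : ℝ) :
    deriv (fun s : ℝ ↦ ε * ((s - s₁) / ε * (1 - smoothTransition ((s - s₁) / ε + 1)))) s =
      deriv (fun x : ℝ ↦ x * (1 - smoothTransition (x + 1))) ((s - s₁) / ε) :=
  (hasDerivAt_height hε s).deriv

/-- On the cylinder part `s ≤ s₁ − ε` the height is `s − s₁` (unit `t*`-speed). [folklore] -/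
theorem height_of_le (hε : 0 < ε) {s : ℝ} (hs : s ≤ s₁ - ε) :
    ε * ((s - s₁) / ε * (1 - smoothTransition ((s - s₁) / ε + 1))) = s - s₁ := by
  have hx : (s - s₁) / ε ≤ -1 := by rw [div_le_iff₀ hε]; linarith
  rw [stopCorner_of_le hx]
  field_simp

/-- On the slice part `s₁ ≤ s` the height vanishes. [folklore] -/
theorem height_of_ge (hε : 0 < ε) {s : ℝ} (hs : s₁ ≤ s) :
    ε * ((s - s₁) / ε * (1 - smoothTransition ((s - s₁) / ε + 1))) = 0 := by
  have hx : 0 ≤ (s - s₁) / ε := div_nonneg (by linarith) hε.le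
  rw [stopCorner_of_nonneg hx, mul_zero]

/-- On the cylinder part the height has derivative `1`. [folklore] -/
theorem deriv_height_of_le (hε : 0 < ε) {s : ℝ} (hs : s ≤ s₁ - ε) :
    deriv (fun s : ℝ ↦ ε * ((s - s₁) / ε * (1 - smoothTransition ((s - s₁) / ε + 1)))) s = 1 := by
  have hx : (s - s₁) / ε ≤ -1 := by rw [div_le_iff₀ hε]; linarith
  rw [deriv_height hε, deriv_stopCorner_of_le hx]

/-- On the slice part the height has derivative `0`. [folklore] -/
theorem deriv_height_of_ge (hε : 0 < ε) {s : ℝ} (hs : s₁ ≤ s) :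
    deriv (fun s : ℝ ↦ ε * ((s - s₁) / ε * (1 - smoothTransition ((s - s₁) / ε + 1)))) s = 0 := by
  have hx : 0 ≤ (s - s₁) / ε := div_nonneg (by linarith) hε.le
  rw [deriv_height hε, deriv_stopCorner_of_nonneg hx]

/-- The height profile is monotone. [folklore] -/
theorem deriv_height_nonneg (hε : 0 < ε) (s : ℝ) :
    0 ≤ deriv (fun s : ℝ ↦ ε * ((s - s₁) / ε * (1 - smoothTransition ((s - s₁) / ε + 1)))) s := by
  rw [deriv_height hε]
  exact deriv_stopCorner_nonneg _

end Height

/-! ### The outer radial chart `ϱ₃(s) = s + d − d S(s − s₁ − 1)` -/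

section Outer

variable {d s₁ : ℝ}

/-- The outer radial profile is `C^∞`. [folklore] -/
theorem contDiff_outer : ContDiff ℝ ∞ (fun s : ℝ ↦ s + d - d * smoothTransition (s - s₁ - 1)) := by
  have hS : ContDiff ℝ ∞ (fun s : ℝ ↦ smoothTransition (s - s₁ - 1)) := by
    have h := contDiff_smoothTransition_affine 1 (-s₁ - 1)
    have e : ∀ x : ℝ, 1 * x + (-s₁ - 1) = x - s₁ - 1 := fun x ↦ by ring
    simp only [e] at h
    exact h
  exact (contDiff_id.add contDiff_const).sub (contDiff_const.mul hS)

/-- The derivative of the outer radial profile is `1 − d S′(s − s₁ − 1)`. [folklore] -/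
theorem hasDerivAt_outer (s : ℝ) :
    HasDerivAt (fun s : ℝ ↦ s + d - d * smoothTransition (s - s₁ - 1))
      (1 - d * deriv smoothTransition (s - s₁ - 1)) s := by
  have hS : HasDerivAt (fun s : ℝ ↦ smoothTransition (s - s₁ - 1)) (deriv smoothTransition (s - s₁ - 1)) s := by
    have h := hasDerivAt_smoothTransition_affine 1 (-s₁ - 1) s
    have e : ∀ x : ℝ, 1 * x + (-s₁ - 1) = x - s₁ - 1 := fun x ↦ by ring
    simp only [e, mul_one] at h
    exact h
  have h := ((hasDerivAt_id' s).add_const d).fun_sub (hS.const_mul d)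
  refine h.congr_deriv ?_
  ring

/-- For `d ≤ 0` the outer radial profile has slope at least one. [folklore] -/
theorem one_le_deriv_outer (hd : d ≤ 0) (s : ℝ) :
    1 ≤ deriv (fun s : ℝ ↦ s + d - d * smoothTransition (s - s₁ - 1)) s := by
  rw [(hasDerivAt_outer s).deriv]
  have : d * deriv smoothTransition (s - s₁ - 1) ≤ 0 :=
    mul_nonpos_of_nonpos_of_nonneg hd smoothTransition.monotone.deriv_nonneg
  linarith

/-- Below `s₁ + 1` the outer radial profile is the translation `s ↦ s + d`. [folklore] -/
theorem outer_of_le {s : ℝ} (hs : s ≤ s₁ + 1) : s + d - d * smoothTransition (s - s₁ - 1) = s + d := by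
  rw [smoothTransition.zero_of_nonpos (by linarith), mul_zero, sub_zero]

/-- Beyond `s₁ + 2` the outer radial profile is the identity. [folklore] -/
theorem outer_of_ge {s : ℝ} (hs : s₁ + 2 ≤ s) : s + d - d * smoothTransition (s - s₁ - 1) = s := by
  rw [smoothTransition.one_of_one_le (by linarith)]; ring

/-- **The outer radial chart.** For `d ≤ 0` the profile `ϱ₃(s) = s + d − d S(s − s₁ − 1)` is a smooth strictly
increasing bijection of `ℝ` with slope `≥ 1`, equal to `s + d` below `s₁ + 1` and to `s` beyond `s₁ + 2`, with a
smooth two-sided inverse `σ`. [folklore] -/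
theorem exists_outer_inverse (hd : d ≤ 0) :
    ∃ σ : ℝ → ℝ, ContDiff ℝ ∞ σ ∧ StrictMono σ ∧
      (∀ s, σ (s + d - d * smoothTransition (s - s₁ - 1)) = s) ∧
      (∀ r, σ r + d - d * smoothTransition (σ r - s₁ - 1) = r) := by
  set Q : ℝ → ℝ := fun s ↦ s + d - d * smoothTransition (s - s₁ - 1) with hQ_def
  have hQs : ContDiff ℝ ∞ Q := contDiff_outer
  have hQd : ∀ s, HasDerivAt Q (deriv Q s) s := fun s ↦ ((hQs.differentiable (by simp)) s).hasDerivAt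
  have hQ' : ∀ s, 0 < deriv Q s := fun s ↦ lt_of_lt_of_le one_pos (one_le_deriv_outer hd s)
  have hmono : StrictMono Q := strictMono_of_deriv_pos hQ'
  have hlo : ∀ s, s ≤ s₁ + 1 → Q s = s + d := fun s hs ↦ outer_of_le hs
  have hhi : ∀ s, s₁ + 2 ≤ s → Q s = s := fun s hs ↦ outer_of_ge hs
  have hsurj : Function.Surjective Q := by
    refine hQs.continuous.surjective ?_ ?_
    · refine tendsto_id.congr' ?_
      filter_upwards [eventually_ge_atTop (s₁ + 2)] with s hs
      exact (hhi s hs).symm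
    · have h1 : Tendsto (fun s : ℝ ↦ s + d) atBot atBot := tendsto_atBot_add_const_right _ _ tendsto_id
      refine h1.congr' ?_
      filter_upwards [eventually_le_atBot (s₁ + 1)] with s hs
      exact (hlo s hs).symm
  set e : ℝ ≃o ℝ := hmono.orderIsoOfSurjective Q hsurj with he_def
  have he : (e : ℝ → ℝ) = Q := hmono.coe_orderIsoOfSurjective Q hsurj
  set Hh : ℝ ≃ₜ ℝ := e.toHomeomorph with hH_def
  have hH : (Hh : ℝ → ℝ) = Q := by rw [hH_def, OrderIso.coe_toHomeomorph, he]
  have hSQ : ∀ s, Hh.symm (Q s) = s := fun s ↦ by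
    have := Hh.symm_apply_apply s
    rwa [hH] at this
  have hQS : ∀ r, Q (Hh.symm r) = r := fun r ↦ by
    have := Hh.apply_symm_apply r
    rwa [hH] at this
  refine ⟨Hh.symm, ?_, ?_, hSQ, hQS⟩
  · refine Hh.contDiff_symm_deriv (f' := deriv Q) (fun s ↦ (hQ' s).ne') (fun s ↦ ?_) (by rw [hH]; exact hQs)
    rw [hH]
    exact hQd s
  · have : (Hh.symm : ℝ → ℝ) = e.symm := by rw [hH_def]; rfl
    rw [this]
    exact e.symm.strictMono

end Outer

end Capping

/-- **Registered export of this file** (sub-goal `capping_outerChart` of stub `stub_capping`, crux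
`stmt-FinalStateConjecture-10052`): the outer radial chart `ϱ₃(s) = s + d − d S(s − s₁ − 1)`, `d ≤ 0`, has a smooth
strictly increasing two-sided inverse, `Capping.exists_outer_inverse`. [folklore] -/
theorem capping_outerChart :
    ∀ (d s₁ : ℝ), d ≤ 0 → ∃ σ : ℝ → ℝ, ContDiff ℝ ∞ σ ∧ StrictMono σ ∧ (∀ s, σ (s + d - d * Real.smoothTransition (s - s₁ - 1)) = s) ∧ (∀ r, σ r + d - d * Real.smoothTransition (σ r - s₁ - 1) = r) :=
  fun _ _ hd ↦ Capping.exists_outer_inverse hd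

end Summit.FinalStateConjecture.FinalStateConjecture.Theorems.SwallowTheDatum.ParametricKerrBurial

end
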